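/-
Copyright (c) 2026 the pub-hodgecm-mathlib formalisation cell (harness21).  Prover seat hodgecm-mathlib-K2E4-p18 (g3), HCML Track B «K2-LIT» ∕ h413
(stmt-HodgeConjecture-24833); line (ii′), sub-letter (H♮), leaf (T2-CPT): FILE 6b — the head (2026-09-04).
-/
import Summits.HodgeConjecture.HodgeConjecture.Theorems.K2E3JointlyAnisotropicPairCompact   -- ★ FILE 6a (this seat): jointly anisotropic pairs
import Literature.NumberTheory.Automorphic.AnisotropicUnitaryGroupCompactLocal              -- ★ uniformiser ∕ compact `𝒪_w` ∕ `localNonsplitEquiv`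
import Literature.NumberTheory.Rogawski1990.ExplicitFactorKappaAlmostEverywhereOne          -- ★ `smul_placesOver_eq_of_subsingleton`
import HarnessLib

/-!
# K2 · E3 — `Theorems/K2E3RankOneEllipticCentralizerCompact.lean` (FILE 6b): (T2-CPT) — THE CENTRALISER IN `U(Φ₂)_v` OF AN ELEMENT WITH IRREDUCIBLE
# CHARACTERISTIC POLYNOMIAL IS COMPACT (Rogawski 1990 §3.6: the elliptic tori of `U(2)` at a non-split place)

HCML Track B «K2-LIT», cell `pub/hodgecm-mathlib`, crux H413 = `stmt-HodgeConjecture-24833` (lane `--supports … --as helper`); seat `hodgecm-mathlib-K2E4-p18` (g3).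
(T2-CPT) is the last non-★ leaf under (RAY¹) of the (Ψ-package₂¹) letter `sig_K2E3RankOneUnipotentScalingPackageOne` (K2E3-plan (g2) 01:04:01Z; consumer
K2E5-p12 (g2)'s `Theorems/K2E3CayleyScalingRankOneRay.lean`, binder shape 01:06:12Z VERBATIM): at a finite place `v` of `L⁺` that does not split in the CM
field `L` (`Subsingleton (PlacesOver L v)`), for `γ ∈ U(Φ₂)(L⁺_v) = (cmDatum L 2 Φ₂).Local v` whose matrix in `GL₂(L ⊗ L⁺_v)` has IRREDUCIBLE characteristic
polynomial, the centraliser `Z_{U(Φ₂)_v}(γ)` is a compact space.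

ROAD (★ FILE 6a; no arithmetic): in the one-place model `U(σ_w, Φ_w)(L_w)` (★ `localNonsplitEquiv`, matrices read at the unique `w ∣ v`) the centraliser of
`g = γ_w` lies in `U(σ_w,Φ_w) ∩ U(σ_w, Φ_w g)` (★ `mem_unitaryGroupOfForm_mul_of_commute`), the pair `(Φ_w, Φ_w g)` is jointly anisotropic (★
`eq_zero_of_hermForm_pair_eq_zero_of_irreducible_charpoly`: `Φ_w` invertible, `χ_g = χ_γ` read at `w` irreducible), so that intersection is compact (★
`isCompact_inter_unitaryGroupOfForm`: `𝒪_w` compact, a uniformiser, `v ∘ σ_w = v`); the centraliser is closed in it; pull back along the homeomorphism.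

* §1 `isCompact_inter_unitaryGroupOfForm_commute`, `isCompact_centralizer_unitaryGroupOfForm` — the one-place statements over any `Valued K ℤᵐ⁰` with
  compact `𝒪` (`2 × 2`, `H` invertible, `χ` irreducible).
* §2 `isCompact_centralizer_local` (the tree's `«local» L c̄ 2 Φ₂ v`) and **`compactSpace_centralizer_of_irreducible_charpoly`** — (T2-CPT), THE HEAD, on
  `(cmDatum L 2 Φ₂).Local v` in K2E5-p12 (g2)'s binder shape.

HONEST LABEL: HC_CM is proved only modulo the 7 printed citations (2 remaining named inputs: hLiu418 = stmt-HodgeConjecture-24832, h413 = stmt-HodgeConjecture-24833) until rung 0 closes.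
Count-neutral helper: (RAY¹) ⟸ {(T2-EX) ★ p856386, (T2-CPT) this file} for the Cayley hand.  No `sorry`, axioms ⊆ {propext, Classical.choice, Quot.sound}, no `def`,
no instance, no notation.

## References
* [Rogawski1990] J. D. Rogawski, *Automorphic Representations of Unitary Groups in Three Variables*, Ann. of Math. Stud. 123 (1990), §3.6 Lemma 3.6.1 p. 28 (elliptic
  tori of `U(2)`), §3.5 Prop. 3.5.2 (c) pp. 25–26.
* [PlatonovRapinchuk1994] V. Platonov, A. Rapinchuk, *Algebraic Groups and Number Theory* (1994), §3.1 Thm. 3.1, §5.1, §6.2.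
* [Flicker1998UnitaryFL] Y. Z. Flicker, Canad. J. Math. 50 (1998), §2 p. 78 (the anisotropic tori of `U(2)`).
-/

set_option autoImplicit false
set_option linter.dupNamespace false

noncomputable section

open scoped Valued WithZero Matrix MatrixGroups
open Matrix Polynomial NumberField IsDedekindDomain
open Literature.NumberTheory.Automorphic Literature.NumberTheory.Automorphic.UnitaryGroup Literature.NumberTheory.Automorphic.HermitianLattice
open Literature.NumberTheory.Rogawski1990 (smul_placesOver_eq_of_subsingleton)
open Summit.HodgeConjecture.HodgeConjecture.Cruxes.H413.K2E3JointlyAnisotropicPairCompact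

namespace Summit.HodgeConjecture.HodgeConjecture.Cruxes.H413.K2E3RankOneEllipticCentralizerCompact

/-! ## §1 The one-place statements -/

section Valued

variable {K : Type*} [Field K] [Valued K ℤᵐ⁰] {ϖ : K} {σ : K →+* K} {H : Matrix (Fin 2) (Fin 2) K}

/-- **`{g ∈ U(σ,H) | gγ = γg}` is compact** for `H` invertible and `χ_γ` irreducible (`𝒪` compact, `v ϖ = exp(−1)`, `v ∘ σ = v`): closed inside the compact
`U(σ,H) ∩ U(σ,Hγ)` (★ FILE 6a). [cite: PlatonovRapinchuk1994, §3.1 Thm. 3.1] [cite: Rogawski1990, §3.6 Lemma 3.6.1 p. 28] -/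
theorem isCompact_inter_unitaryGroupOfForm_commute [CompactSpace 𝒪[K]] (hϖ : Valued.v ϖ = WithZero.exp (-1 : ℤ))
    (hσ : ∀ x, Valued.v (σ x) = Valued.v x) (hH : IsUnit H) {γ : Matrix (Fin 2) (Fin 2) K} (hirr : Irreducible γ.charpoly) :
    IsCompact (((unitaryGroupOfForm σ H : Subgroup (GL (Fin 2) K)) : Set (GL (Fin 2) K)) ∩
      (Units.val ⁻¹' {A : Matrix (Fin 2) (Fin 2) K | A * γ = γ * A})) := by
  have hanis := eq_zero_of_hermForm_pair_eq_zero_of_irreducible_charpoly (σ := σ) hH hirr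
  have hcpt := isCompact_inter_unitaryGroupOfForm (H₁ := H) (H₂ := H * γ) hϖ hσ hanis
  refine hcpt.of_isClosed_subset ?_ ?_
  · exact (isClosed_unitaryGroupOfForm (continuous_of_forall_v_eq hσ) H).inter
      ((isClosed_eq (continuous_id.mul continuous_const) (continuous_const.mul continuous_id)).preimage Units.continuous_val)
  · rintro g ⟨hg, hc⟩
    exact ⟨hg, mem_unitaryGroupOfForm_mul_of_commute hg hc⟩

/-- **The centraliser of `g` in `U(σ, H)` is compact** when `H` is invertible and `χ_g` is irreducible (same frame): its image in `GL₂(K)` is the compact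
set of the previous lemma. [cite: PlatonovRapinchuk1994, §3.1 Thm. 3.1] [cite: Rogawski1990, §3.6 Lemma 3.6.1 p. 28] -/
theorem isCompact_centralizer_unitaryGroupOfForm [CompactSpace 𝒪[K]] (hϖ : Valued.v ϖ = WithZero.exp (-1 : ℤ))
    (hσ : ∀ x, Valued.v (σ x) = Valued.v x) (hH : IsUnit H) (g : ↥(unitaryGroupOfForm σ H))
    (hirr : Irreducible ((g : GL (Fin 2) K) : Matrix (Fin 2) (Fin 2) K).charpoly) :
    IsCompact ((Subgroup.centralizer ({g} : Set ↥(unitaryGroupOfForm σ H)) : Set ↥(unitaryGroupOfForm σ H))) := by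
  have hC := isCompact_inter_unitaryGroupOfForm_commute hϖ hσ hH hirr
  have himg : Subtype.val '' ((Subgroup.centralizer ({g} : Set ↥(unitaryGroupOfForm σ H))) : Set ↥(unitaryGroupOfForm σ H)) =
      ((unitaryGroupOfForm σ H : Subgroup (GL (Fin 2) K)) : Set (GL (Fin 2) K)) ∩
        (Units.val ⁻¹' {A : Matrix (Fin 2) (Fin 2) K | A * ((g : GL (Fin 2) K) : Matrix (Fin 2) (Fin 2) K) =
          ((g : GL (Fin 2) K) : Matrix (Fin 2) (Fin 2) K) * A}) := by
    ext u
    constructor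
    · rintro ⟨t, ht, rfl⟩
      refine ⟨t.2, ?_⟩
      have h := Subgroup.mem_centralizer_singleton_iff.1 ht
      have h' := congrArg (fun s : ↥(unitaryGroupOfForm σ H) => ((s : GL (Fin 2) K) : Matrix (Fin 2) (Fin 2) K)) h
      simpa only [Set.mem_preimage, Set.mem_setOf_eq, Subgroup.coe_mul, Units.val_mul] using h'
    · rintro ⟨hu, hc⟩
      refine ⟨⟨u, hu⟩, ?_, rfl⟩
      refine Subgroup.mem_centralizer_singleton_iff.2 ?_
      apply Subtype.ext
      apply Units.ext
      simpa only [Set.mem_preimage, Set.mem_setOf_eq, Subgroup.coe_mul, Units.val_mul] using hc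
  have key : IsCompact (Subtype.val '' ((Subgroup.centralizer ({g} : Set ↥(unitaryGroupOfForm σ H))) : Set ↥(unitaryGroupOfForm σ H))) := by
    rw [himg]
    exact hC
  exact Topology.IsInducing.subtypeVal.isCompact_iff.2 key

end Valued

/-! ## §2 (T2-CPT): the CM packaging -/

/-- **Compact centraliser in the tree's local group `U(Φ₂)(L⁺_v) = «local» L c̄ 2 Φ₂ v`** at a non-split `v`, for `γ` with irreducible characteristic polynomial
over `L ⊗ L⁺_v`: the one-place model `e = localNonsplitEquiv` (matrices read at the unique `w ∣ v`, so `χ_{e γ} = χ_γ` read through `L ⊗ L⁺_v ≃+* L_w`) carries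
`Z(γ)` onto the compact `Z(e γ)` of §1. [cite: Rogawski1990, §3.6 Lemma 3.6.1 p. 28] [cite: PlatonovRapinchuk1994, §3.1 Thm. 3.1; §5.1] -/
theorem isCompact_centralizer_local (L : Type) [Field L] [NumberField L] [IsCMField L]
    {v : HeightOneSpectrum (𝓞 ↥(maximalRealSubfield L))} (hsub : Subsingleton (UnitaryGroup.PlacesOver L v))
    (γ : ↥(«local» L (IsCMField.complexConj L) 2 (Matrix.of fun i j : Fin 2 => if i.val + j.val + 1 = 2 then (1 : L) else 0) v)) (hirr : Irreducible (((γ.val : GL (Fin 2) (UnitaryGroup.LocalRing L v)).val).charpoly)) :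
    IsCompact ((Subgroup.centralizer ({γ} : Set ↥(«local» L (IsCMField.complexConj L) 2 (Matrix.of fun i j : Fin 2 => if i.val + j.val + 1 = 2 then (1 : L) else 0) v))) : Set ↥(«local» L (IsCMField.complexConj L) 2 (Matrix.of fun i j : Fin 2 => if i.val + j.val + 1 = 2 then (1 : L) else 0) v)) := by
  obtain ⟨w⟩ := UnitaryGroup.PlacesOver.nonempty L v
  have hw : IsCMField.complexConj L • w.1 = w.1 := smul_placesOver_eq_of_subsingleton L v (IsCMField.complexConj L) hsub w
  haveI : Algebra.IsQuadraticExtension ↥(maximalRealSubfield L) L := IsCMField.isQuadraticExtension L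
  letI : Unique (UnitaryGroup.PlacesOver L v) := @uniqueOfSubsingleton _ hsub w
  haveI := compactSpace_integer_adicCompletion L w.1
  obtain ⟨ϖ, hϖ⟩ := exists_v_eq_exp_neg_one_adicCompletion w.1
  have hσ : ∀ x, Valued.v (galAdicCompletionMap (L := L) (IsCMField.complexConj L) hw x) = Valued.v x :=
    fun x => valued_galAdicCompletionMap (L := L) (IsCMField.complexConj L) hw x
  have hH : IsUnit (placeForm (Matrix.of fun i j : Fin 2 => if i.val + j.val + 1 = 2 then (1 : L) else 0) w.1) :=
    isUnit_placeForm_of_isUnit_det (isUnit_antidiagOne_det L 2) w.1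
  -- the one-place model
  let e := localNonsplitEquiv (IsCMField.complexConj L) (Matrix.of fun i j : Fin 2 => if i.val + j.val + 1 = 2 then (1 : L) else 0) (IsCMField.complexConj_ne_one L) w hw
  -- irreducibility read at `w`
  let π : UnitaryGroup.LocalRing L v ≃+* w.1.adicCompletion L := RingEquiv.piUnique fun w' : UnitaryGroup.PlacesOver L v => w'.1.adicCompletion L
  have hMat : ((e γ : GL (Fin 2) (w.1.adicCompletion L)) : Matrix (Fin 2) (Fin 2) (w.1.adicCompletion L)) =
      ((γ.val : GL (Fin 2) (UnitaryGroup.LocalRing L v)).val).map (π : UnitaryGroup.LocalRing L v →+* w.1.adicCompletion L) := rfl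
  have hirr' : Irreducible ((e γ : GL (Fin 2) (w.1.adicCompletion L)) : Matrix (Fin 2) (Fin 2) (w.1.adicCompletion L)).charpoly := by
    rw [hMat, Matrix.charpoly_map]
    have h := (MulEquiv.irreducible_iff (Polynomial.mapEquiv π)).2 hirr
    rwa [Polynomial.mapEquiv_apply] at h
  -- the compact centraliser of the model, pulled back along `e`
  have hC := isCompact_centralizer_unitaryGroupOfForm hϖ hσ hH (e γ) hirr'
  have hpre : ((Subgroup.centralizer ({γ} : Set ↥(«local» L (IsCMField.complexConj L) 2 (Matrix.of fun i j : Fin 2 => if i.val + j.val + 1 = 2 then (1 : L) else 0) v))) : Set ↥(«local» L (IsCMField.complexConj L) 2 (Matrix.of fun i j : Fin 2 => if i.val + j.val + 1 = 2 then (1 : L) else 0) v)) =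
      e ⁻¹' ((Subgroup.centralizer ({e γ} :
        Set ↥(unitaryGroupOfForm (galAdicCompletionMap (L := L) (IsCMField.complexConj L) hw) (placeForm (Matrix.of fun i j : Fin 2 => if i.val + j.val + 1 = 2 then (1 : L) else 0) w.1)))) : Set _) := by
    ext x
    rw [Set.mem_preimage, SetLike.mem_coe, SetLike.mem_coe, Subgroup.mem_centralizer_singleton_iff, Subgroup.mem_centralizer_singleton_iff]
    constructor
    · intro h
      rw [← map_mul, ← map_mul, h]
    · intro h
      exact e.injective (by rw [map_mul, map_mul]; exact h)
  rw [hpre]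
  exact e.toHomeomorph.isCompact_preimage.2 hC

/-- **(T2-CPT) — THE CENTRALISER IN `U(Φ₂)(L⁺_v)` OF AN ELEMENT WITH IRREDUCIBLE CHARACTERISTIC POLYNOMIAL IS COMPACT** (`v` non-split in the CM field
`L`, i.e. one place `w` above `v`; `χ_γ` over `L ⊗ L⁺_v = L_w`).  Binder shape = K2E5-p12 (g2) 01:06:12Z.  The elliptic torus `Z(γ) = L_w[γ]^× ∩ U(Φ₂)` is the
norm-one group of the quadratic extension `L_w[γ] ⊃ L_w[γ]^τ`; here: `Z(γ) ≤ U(Φ_w) ∩ U(Φ_w γ_w)`, a jointly anisotropic pair (★ FILE 6a), compact.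
[cite: Rogawski1990, §3.6 Lemma 3.6.1 p. 28; §3.5 Prop. 3.5.2 (c) pp. 25–26] [cite: PlatonovRapinchuk1994, §3.1 Thm. 3.1; §6.2] [cite: Flicker1998UnitaryFL, §2 p. 78] -/
theorem compactSpace_centralizer_of_irreducible_charpoly (L : Type) [Field L] [NumberField L] [IsCMField L]
    {v : HeightOneSpectrum (𝓞 ↥(maximalRealSubfield L))} (hsub : Subsingleton (UnitaryGroup.PlacesOver L v))
    (γ : (UnitaryGroup.cmDatum L 2 (Matrix.of fun i j : Fin 2 => if i.val + j.val + 1 = 2 then (1 : L) else 0)).Local v)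
    (hirr : Irreducible (((γ.val : GL (Fin 2) (UnitaryGroup.LocalRing L v)).val).charpoly)) :
    CompactSpace ↥(Subgroup.centralizer ({γ} : Set ((UnitaryGroup.cmDatum L 2 (Matrix.of fun i j : Fin 2 => if i.val + j.val + 1 = 2 then (1 : L) else 0)).Local v))) :=
  isCompact_iff_compactSpace.1 (isCompact_centralizer_local L hsub γ hirr)

end Summit.HodgeConjecture.HodgeConjecture.Cruxes.H413.K2E3RankOneEllipticCentralizerCompact

end
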